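import Literature.MathematicalPhysics.QuantumFieldTheory.Balaban1983to89.B6Ineq243TwoLevelBox

/-!
# `Balaban1983to89.B6MultiLevelBoxOperator` — [B6] (2.1)–(2.4), (2.13)–(2.14): the GENUINE `k`-LEVEL operator
`Δ′_a = −Δ^{η,N}_X + Σ_{j=1}^{k} a_j(L^jη)^{−2}Q′_j*1_{Λ_j}Q′_j` on a Neumann box `X`, for an ARBITRARY nested family of
block-union domains `X = Ω₁ ⊃ Ω₂ ⊃ … ⊃ Ω_k` satisfying (2.1)–(2.2); its positivity and its inverse `G′ = Δ′_a⁻¹`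
(file 1 of the multi-level parametrix of p. 229–234; no existing module is touched; no fact is minted)

FRAMING (verbatim cell line):
statement-level skeleton of published theorems with citation tags; proofs where landed; nothing here is a claim about the Yang–Mills mass gap

Source under audit (cell pub-balaban / lit-balaban): T. Bałaban, *Propagators and renormalization transformations for
lattice gauge theories. II*, Commun. Math. Phys. **96** (1984) 223–250 [`Balaban1984PropagatorsII`, "B6"], p. 224 [PDF 2]
(2.1)–(2.4), p. 225 [PDF 3] (2.13)–(2.14), p. 229 [PDF 7] (the boundary-condition paragraph), renders
`run/shared/lean/pub/pub-balaban/b2b-balaban-ref1/pages/1984-cmp96-propagators-rt-II/…-p002/p003/p007-x2.png` read as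
images this generation (unit `lit-balaban-p21`, Phase-2 proof seat p21 gen 10, HOME `run/shared/lean/pub/lit-balaban/`,
free-target protocol G.5-34(d), B6 fold owner r03, referee ref-4).

## WHAT IS PRINTED (verbatim up to notation)

p. 224: «Let us consider a sequence of domains Ω₁ ⊃ Ω₂ ⊃ … ⊃ Ω_k … Ω_j = B^j(Ω_j^{(j)}), Ω_j^{(j)} ⊂ T^{(j)}_{L^jη} is a sum
of big blocks, (2.1) … (L^jη)^{−1}dist(Ω_j^c, Ω_{j+1}) > RM, where M is a size of big blocks and R is a big positive
integer fixed later (2.2). … Λ_j = Ω_j^{(j)} ∖ Ω_{j+1}^{(j)}, j = 1, …, k − 1, Λ_k = Ω_k^{(k)}, Λ₀ = Ω₁^c (2.3) …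
T_η = ⋃_{j=0}^{k} B^j(Λ_j) (2.4)».  p. 225: «Δ′_a = Δ + Q′*aQ′ and the operator Q′*aQ′ is given by the quadratic form
⟨λ, Q′*aQ′λ⟩ = Σ_{j=0}^{k} Σ_{y∈Λ_j} a_j(L^jη)^{d−2}|(Q′_jλ)(y)|². (2.14) The numbers a_j satisfy the recursive equations
a_{j+1} = aa_j/(aL^{−2} + a_j), a₁ = a … The operator G′ = Δ′_a^{−1} is a well defined, positive operator because Δ′_a
satisfies the inequality (2.11) for all λ, with min{a_j, π²} instead of π² and the index j running from 0 to k».  p. 229: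
«If we are interested in a Green's function for this operator considered on a domain Ω ⊂ T_η, we have to introduce some
boundary conditions. We can do it taking a sequence (2.1) with Ω = Ω_k … Boundary conditions of this type can be
interpreted as obtained by building an effective mass on the domain Ω₁∖Ω_k, starting from O(1) on Ω_k up to +∞ outside Ω₁.»

## WHAT THIS FILE CERTIFIES (kernel-checked; units of the two-level lane `B6Ineq243TwoLevelBox`)

Lattice units (`η = 1`; the fine lattice sites of the box `X = Π_μ[0, N₀_μ)`, `N₀_μ = L^k·L·M_h·P_μ`, `L = ℓ + 1 ≥ 2`,
big blocks of side `M = L·M_h` in the units of their level, i.e. `M·L^j = M_h·L^{j+1}` fine sites at level `j`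
(`bigSide`); `j`-blocks = cubes of `L^j` fine sites, `blk (L^j)`).
* `Domains` — **(2.1)–(2.2) AS A STRUCTURE**: the level function `lev` (print's `x ∈ B^j(Λ_j) ⇔ lev x = j`, so
  `Ω_j = {j ≤ lev}`, `Λ_j`-territory `= {lev = j}`, (2.3)–(2.4) built in), with `1 ≤ lev ≤ k` (Ω₁ = X, see HONEST
  SCOPE), **(2.1)** `Ω_j` a union of big `j`-blocks (`bigBlocks`), **(2.2)** `dist_∞(Ω_j^c, Ω_{j+1}) > R·M·L^j`
  (`sep`); derived: every territory is a union of blocks of its own level (`lev_eq_of_blk_eq`), and the TWO-LEVEL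
  WINDOW (`lev_window`, `not_both_sides`): for `R ≥ 2L` a cube of side `< 2ML^j` meeting `B^j(Λ_j)` meets only the
  levels `j − 1, j, j + 1` and never both `j − 1` and `j + 1` — print p. 230 «□ … intersecting maybe the domain
  B^{j+1}(Λ_{j+1})», the geometric input of the multi-size parametrix (file 2).
* `mlOp` — **THE GENUINE `k`-LEVEL OPERATOR (2.13)–(2.14)** as a real matrix on the fine box (values form, Neumann
  Laplacian of `B4Reflection242.neumannLapK`): entries (`mlOp_apply`)
  `(−Δ^N_X)(x,x′) + a_j·L^{−2j}·L^{−j(d+1)}·[x′ ∼_j x]` with `j = lev x` — i.e. `Σ_j a_j(L^j)^{−2}Q′_j*1_{Λ_j}Q′_j`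
  with the NORMALISED block averages `Q′_j` (the `(L^jη)^{d−2}|Q′_jλ(y)|²` of (2.14) in lattice units); its quadratic
  form (`mlOp_form`) `⟨v, Δ′_av⟩ = ½ΣΣ(v_x − v_{x′})² + Σ_j a_jL^{−2j}L^{−j(d+1)}Σ_{y∈Λ_j}(Σ_{x∈B^j(y)}v_x)²`,
  symmetry, **positivity / injectivity** (`mlOp_mulVec_injective`: the printed «G′ = Δ′_a^{−1} is a well defined,
  positive operator», by the zero-mode argument of `B4Green242Bridge.opBox_mulVec_injective`), and the INVERSE
  `gml = G′` with `Δ′_aG′ = G′Δ′_a = 1` (`mlOp_mul_gml`, `gml_mul_mlOp`), for EVERY `k ≥ 1`, every nested family, every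
  positive weight sequence `a_j`; transport across presentations of the same box (`mlOp_boxCast`).
* the printed weights: `aPrinted a j = B1.aSeq a L j` satisfies `a_{j+1} = aNext ℓ a_j a` (`aPrinted_succ`) and lies in
  the window `[a(1 − L^{−2}), a]` (`aPrinted_window`) — the hypotheses under which files 2–3 consume the two-level cube
  theorems of `B6Ineq243TwoLevelBox` uniformly in `j`.

## HONEST SCOPE

* Box `X` with Neumann conditions in place of the torus `T_η` (as in the whole two-level lane); `A = 0` (there is no
  gauge field in §2.B); levels `j = 1, …, k` with `Ω₁ = X`: print's level `0` (`Λ₀ = T_η ∖ Ω₁`, where (2.7) imposes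
  `λ = 0`, i.e. `a₀ = +∞`, «an effective mass … up to +∞ outside Ω₁») is NOT modelled — the operator of this file is
  print's `Δ′_a` for sequences with `Ω₁ = T_η`; a finite `a₀` (the reading of `B6SectAScalarModelV1`) is not used either.
* `dist` of (2.2) read in the sup-norm of the fine lattice (print does not fix the norm); the big blocks of level `j`
  are the cubes of the grid `(M L^j)ℤ^{d+1}` (print: «a sum of big blocks»); the weights `a_j` are free positive
  parameters (print's `a_j = B1.aSeq a L j`, `aPrinted`).
* Nothing is inferred from the manuscript: every step is kernel-checked; the quoted sentences locate the statements.
-/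

namespace Literature.MathematicalPhysics.QuantumFieldTheory.Balaban1983to89.B6MultiLevelBoxOperator

open Finset Matrix
open Literature.MathematicalPhysics.QuantumFieldTheory.Balaban1983to89.B4ContourShift (supNorm abs_le_supNorm
  supNorm_nonneg)
open Literature.MathematicalPhysics.QuantumFieldTheory.Balaban1983to89.B4Reflection242 (boxDom mem_boxDom nbrs mem_nbrs
  blk neumannLapK diagK avgK supNorm_add_le)
open Literature.MathematicalPhysics.QuantumFieldTheory.Balaban1983to89.B4Green242Bridge (boxNbrs boxBlk mem_boxBlk_self
  zero_mem_boxDom box_const_of_bonds)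
open Literature.MathematicalPhysics.QuantumFieldTheory.Balaban1983to89.B4BoxCov237 (opBoxR opBoxR_isSymm quadFormR_eq
  opBoxR_mulVec)
open Literature.MathematicalPhysics.QuantumFieldTheory.Balaban1983to89.B4Thm110ZeroBox (boxCast boxCast_apply_val blk_blk
  supNorm_sub_le_sub_add_sub one_lt_L_real aSeq_window)
open Literature.MathematicalPhysics.QuantumFieldTheory.Balaban1983to89.B6Ineq243TwoLevelBox (aNext aNext_aSeq)

noncomputable section

variable {d : ℕ}

/-! ## §1 Scales and the fine box -/

/-- the fine box `X = Π_μ[0, N₀_μ)`, `N₀_μ = L^k·(L·(M_h·P_μ))` fine sites: `P_μ` top-level cube half-widths `M·L^k`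
per direction (`M = L·M_h`). [cite: Balaban1984PropagatorsII, (2.1) p.224, dictionary] -/
abbrev N0 (ℓ Mh k : ℕ) (P : Fin (d + 1) → ℕ) : Fin (d + 1) → ℕ := fun i => (ℓ + 1) ^ k * ((ℓ + 1) * (Mh * P i))

/-- the side of the big blocks of level `j` in fine sites: `M·L^j = M_h·L^{j+1}` («big blocks of the size ML^jη»).
[cite: Balaban1984PropagatorsII, p.229 («Each set Λ_j is a sum of big blocks of the size ML^jη»)] -/
def bigSide (ℓ Mh j : ℕ) : ℕ := Mh * (ℓ + 1) ^ (j + 1)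

/-- `bigSide j = L^j·(M_h·L)` (big blocks are unions of `j`-blocks). [cite: Balaban1984PropagatorsII, (2.1) p.224 («Ω_j^{(j)} … is a sum of big blocks»), dictionary] -/
theorem bigSide_eq (ℓ Mh j : ℕ) : bigSide ℓ Mh j = (ℓ + 1) ^ j * (Mh * (ℓ + 1)) := by
  unfold bigSide; ring

/-- `bigSide (j+1) = L^j·(M_h·L²)` (big `(j+1)`-blocks are unions of `j`-blocks). [cite: Balaban1984PropagatorsII, (2.1) p.224, dictionary] -/
theorem bigSide_succ_eq (ℓ Mh j : ℕ) : bigSide ℓ Mh (j + 1) = (ℓ + 1) ^ j * (Mh * (ℓ + 1) ^ 2) := by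
  unfold bigSide; ring

/-- `bigSide (j+1) = L·bigSide j` (consecutive scales differ by the factor `L`). [cite: Balaban1984PropagatorsII, (2.1)–(2.2) p.224, dictionary] -/
theorem bigSide_succ (ℓ Mh j : ℕ) : bigSide ℓ Mh (j + 1) = (ℓ + 1) * bigSide ℓ Mh j := by
  unfold bigSide; ring

/-- `bigSide j ≥ 1` for `M_h ≥ 1`. [cite: Balaban1984PropagatorsII, (2.1) p.224, dictionary] -/
theorem one_le_bigSide {ℓ Mh : ℕ} (hMh : 1 ≤ Mh) (j : ℕ) : 1 ≤ bigSide ℓ Mh j :=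
  Nat.one_le_iff_ne_zero.2 (Nat.mul_ne_zero_iff.2 ⟨by omega, by positivity⟩)

/-! ## §2 (2.1)–(2.4) as a structure: the level function of a nested family of block-union domains -/

/-- **(2.1)–(2.2) ON THE BOX `X`** (levels `1, …, k`, `Ω₁ = X`): a nested family `X = Ω₁ ⊃ Ω₂ ⊃ … ⊃ Ω_k` is recorded by
its LEVEL FUNCTION `lev` — `x ∈ B^j(Λ_j) ⇔ lev x = j` ((2.3)–(2.4): `Λ_j = Ω_j ∖ Ω_{j+1}`, `Λ_k = Ω_k`,
`T = ⋃_j B^j(Λ_j)`), so that `Ω_j = {x : j ≤ lev x}`; **(2.1)** «Ω_j^{(j)} is a sum of big blocks»: membership in `Ω_j`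
(`2 ≤ j ≤ k`) depends only on the big `j`-block (side `M·L^j` fine sites; `Ω₁ = X` needs no condition); **(2.2)**
«(L^jη)^{−1}dist(Ω_j^c, Ω_{j+1}) > RM»: a point below level `j` and a point at level `≥ j + 1` are more than `R·M·L^j`
apart (sup-norm of the fine lattice).  Parameters: dimension `d + 1`, `L = ℓ + 1`, `M = L·M_h`, `k` levels, box
half-widths `P`, the integer `R`. [cite: Balaban1984PropagatorsII, (2.1)–(2.4) p.224] -/
structure Domains (d ℓ Mh k : ℕ) (P : Fin (d + 1) → ℕ) (R : ℕ) where
  /-- the level of (the territory `B^j(Λ_j)` containing) a fine site -/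
  lev : (Fin (d + 1) → ℤ) → ℕ
  one_le_lev : ∀ x, 1 ≤ lev x
  lev_le : ∀ x, lev x ≤ k
  /-- (2.1): `Ω_j = {j ≤ lev}` is a union of big `j`-blocks, `2 ≤ j` -/
  bigBlocks : ∀ j, 2 ≤ j → ∀ x ∈ boxDom (N0 ℓ Mh k P), ∀ x' ∈ boxDom (N0 ℓ Mh k P),
    blk (bigSide ℓ Mh j) x' = blk (bigSide ℓ Mh j) x → (j ≤ lev x ↔ j ≤ lev x')
  /-- (2.2): `dist(Ω_j^c, Ω_{j+1}) > R·M·L^j` -/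
  sep : ∀ j, ∀ x ∈ boxDom (N0 ℓ Mh k P), ∀ x' ∈ boxDom (N0 ℓ Mh k P), lev x < j → j + 1 ≤ lev x' →
    ((R * bigSide ℓ Mh j : ℕ) : ℝ) < supNorm (x - x')

namespace Domains

variable {ℓ Mh k R : ℕ} {P : Fin (d + 1) → ℕ} (D : Domains d ℓ Mh k P R)

/-- **THE TRIVIAL MEMBER** `Ω₁ = … = Ω_k = X` (every site at level `k`): the structure is inhabited for every
parameter set. [cite: Balaban1984PropagatorsII, (2.1) p.224 (the one-domain sequence)] -/
def top (d ℓ Mh k : ℕ) (P : Fin (d + 1) → ℕ) (R : ℕ) (hk : 1 ≤ k) : Domains d ℓ Mh k P R where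
  lev := fun _ => k
  one_le_lev := fun _ => hk
  lev_le := fun _ => le_rfl
  bigBlocks := fun _ _ _ _ _ _ _ => Iff.rfl
  sep := fun j x _ x' _ (h1 : k < j) (h2 : j + 1 ≤ k) => by exfalso; omega

/-- the territory `B^j(Λ_j) = {lev = j}` and the domain `Ω_j = {j ≤ lev}`, as predicates. [cite: Balaban1984PropagatorsII, (2.3)–(2.4) p.224] -/
def terr (j : ℕ) (x : Fin (d + 1) → ℤ) : Prop := D.lev x = j

/-- (2.3)–(2.4): `x ∈ Ω_j ⇔ j ≤ lev x`; in particular `Ω₁ = X`, `Ω_j ⊃ Ω_{j+1}` and the territories partition `X`.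
[cite: Balaban1984PropagatorsII, (2.3)–(2.4) p.224] -/
def omega (j : ℕ) (x : Fin (d + 1) → ℤ) : Prop := j ≤ D.lev x

/-- nesting (2.1): `Ω_{j+1} ⊂ Ω_j`. [cite: Balaban1984PropagatorsII, (2.1) p.224] -/
theorem omega_succ_subset (j : ℕ) (x : Fin (d + 1) → ℤ) (h : D.omega (j + 1) x) : D.omega j x :=
  le_trans (Nat.le_succ j) h

/-- `Ω₁ = X`. [cite: Balaban1984PropagatorsII, (2.1) p.224] -/
theorem omega_one (x : Fin (d + 1) → ℤ) : D.omega 1 x := D.one_le_lev x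

/-- (2.3): `Λ_j`-territory `= Ω_j ∖ Ω_{j+1}`. [cite: Balaban1984PropagatorsII, (2.3) p.224] -/
theorem terr_iff (j : ℕ) (x : Fin (d + 1) → ℤ) : D.terr j x ↔ D.omega j x ∧ ¬ D.omega (j + 1) x := by
  unfold terr omega; omega

/-- **EVERY TERRITORY IS A UNION OF BLOCKS OF ITS OWN LEVEL** (from (2.1) at levels `j` and `j + 1`): two sites of the
box in the same `L^{lev x}`-block have the same level. [cite: Balaban1984PropagatorsII, (2.1)+(2.3) p.224] -/
theorem lev_eq_of_blk_eq {x x' : Fin (d + 1) → ℤ} (hx : x ∈ boxDom (N0 ℓ Mh k P)) (hx' : x' ∈ boxDom (N0 ℓ Mh k P))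
    (h : blk ((ℓ + 1) ^ D.lev x) x' = blk ((ℓ + 1) ^ D.lev x) x) : D.lev x' = D.lev x := by
  have hb1 : blk (bigSide ℓ Mh (D.lev x)) x' = blk (bigSide ℓ Mh (D.lev x)) x := by
    rw [bigSide_eq, ← blk_blk (Mh * (ℓ + 1)) ((ℓ + 1) ^ D.lev x) x',
      ← blk_blk (Mh * (ℓ + 1)) ((ℓ + 1) ^ D.lev x) x, h]
  have hb2 : blk (bigSide ℓ Mh (D.lev x + 1)) x' = blk (bigSide ℓ Mh (D.lev x + 1)) x := by
    rw [bigSide_succ_eq, ← blk_blk (Mh * (ℓ + 1) ^ 2) ((ℓ + 1) ^ D.lev x) x',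
      ← blk_blk (Mh * (ℓ + 1) ^ 2) ((ℓ + 1) ^ D.lev x) x, h]
  have h1 := D.one_le_lev x
  have hge : D.lev x ≤ D.lev x' := by
    rcases Nat.lt_or_ge 1 (D.lev x) with hlt | hle
    · exact (D.bigBlocks (D.lev x) hlt x hx x' hx' hb1).1 le_rfl
    · have : D.lev x = 1 := le_antisymm hle h1
      rw [this]; exact D.one_le_lev x'
  have hle : D.lev x' ≤ D.lev x := by
    by_contra hlt
    have h2 : D.lev x + 1 ≤ D.lev x' := by omega
    have h3 := (D.bigBlocks (D.lev x + 1) (by omega) x hx x' hx' hb2).2 h2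
    omega
  exact le_antisymm hle hge

/-- the same, for the block side of an arbitrary level `i ≤ lev x` (a territory is a union of finer blocks too).
[cite: Balaban1984PropagatorsII, (2.1)+(2.3) p.224] -/
theorem lev_eq_of_blk_eq_of_le {x x' : Fin (d + 1) → ℤ} (hx : x ∈ boxDom (N0 ℓ Mh k P))
    (hx' : x' ∈ boxDom (N0 ℓ Mh k P)) {i : ℕ} (hi : i ≤ D.lev x)
    (h : blk ((ℓ + 1) ^ i) x' = blk ((ℓ + 1) ^ i) x) : D.lev x' = D.lev x := by
  refine D.lev_eq_of_blk_eq hx hx' ?_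
  obtain ⟨t, ht⟩ := Nat.exists_eq_add_of_le hi
  rw [ht, pow_add, ← blk_blk, ← blk_blk, h]

/-! ### The two-level window of a cube (p. 230 «□ … intersecting maybe the domain B^{j+1}(Λ_{j+1})») -/

/-- **LEVELS SEEN FROM A `j`-CUBE**: for `R ≥ 2L`, a site within sup-distance `< 2ML^j` of a site of `B^j(Λ_j)` has
level `j − 1`, `j` or `j + 1`. [cite: Balaban1984PropagatorsII, (2.2) p.224 with p.230 («intersecting maybe the domain B^{j+1}(Λ_{j+1})»)] -/
theorem lev_window (hR : 2 * (ℓ + 1) ≤ R) {t x : Fin (d + 1) → ℤ} (ht : t ∈ boxDom (N0 ℓ Mh k P))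
    (hx : x ∈ boxDom (N0 ℓ Mh k P)) {j : ℕ} (htj : D.lev t = j)
    (hxt : supNorm (x - t) < 2 * (bigSide ℓ Mh j : ℝ)) : j ≤ D.lev x + 1 ∧ D.lev x ≤ j + 1 := by
  have hL1 : (1 : ℝ) ≤ (ℓ : ℝ) + 1 := by
    have : (0 : ℝ) ≤ ℓ := by positivity
    linarith
  have hR' : (2 : ℝ) * ((ℓ : ℝ) + 1) ≤ R := by exact_mod_cast hR
  have hR2 : (2 : ℝ) ≤ R := by nlinarith
  have hbs : ∀ i : ℕ, (0 : ℝ) ≤ (bigSide ℓ Mh i : ℝ) := fun i => by positivity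
  constructor
  · by_contra hlt
    push Not at hlt
    -- `lev x + 2 ≤ j`: apply (2.2) at level `j - 1` to the pair `(x, t)`
    have hj1 : 1 ≤ j := by rw [← htj]; exact D.one_le_lev t
    obtain ⟨i, rfl⟩ : ∃ i, j = i + 1 := ⟨j - 1, by omega⟩
    have hsep := D.sep i x hx t ht (by omega) (by omega)
    have e : (bigSide ℓ Mh (i + 1) : ℝ) = ((ℓ : ℝ) + 1) * bigSide ℓ Mh i := by
      rw [bigSide_succ]; push_cast; ring
    rw [e] at hxt
    have h1 : ((R * bigSide ℓ Mh i : ℕ) : ℝ) = (R : ℝ) * bigSide ℓ Mh i := by push_cast; ring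
    rw [h1] at hsep
    nlinarith [hbs i]
  · by_contra hlt
    push Not at hlt
    -- `j + 2 ≤ lev x`: apply (2.2) at level `j + 1` to the pair `(t, x)`
    have hsep := D.sep (j + 1) t ht x hx (by omega) (by omega)
    have e : (bigSide ℓ Mh (j + 1) : ℝ) = ((ℓ : ℝ) + 1) * bigSide ℓ Mh j := by
      rw [bigSide_succ]; push_cast; ring
    have h1 : ((R * bigSide ℓ Mh (j + 1) : ℕ) : ℝ) = (R : ℝ) * (((ℓ : ℝ) + 1) * bigSide ℓ Mh j) := by
      rw [← e]; push_cast; ring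
    rw [h1] at hsep
    have hsym : supNorm (t - x) = supNorm (x - t) := by
      rw [← B4TorusKernel.supNorm_neg, neg_sub]
    rw [hsym] at hsep
    nlinarith [hbs j]

/-- **NEVER BOTH NEIGHBOURING LEVELS**: for `R ≥ 2L`, two sites within `< 2ML^j` of a common site cannot have levels
`j − 1` and `j + 1` (by (2.2) at level `j`, `R ≥ 4`). [cite: Balaban1984PropagatorsII, (2.2) p.224 with p.230] -/
theorem not_both_sides (hℓ : 1 ≤ ℓ) (hR : 2 * (ℓ + 1) ≤ R) {t x x' : Fin (d + 1) → ℤ}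
    (hx : x ∈ boxDom (N0 ℓ Mh k P)) (hx' : x' ∈ boxDom (N0 ℓ Mh k P)) {j : ℕ}
    (hxt : supNorm (x - t) < 2 * (bigSide ℓ Mh j : ℝ)) (hx't : supNorm (x' - t) < 2 * (bigSide ℓ Mh j : ℝ))
    (hlx : D.lev x + 1 = j) (hlx' : D.lev x' = j + 1) : False := by
  have hR4 : (4 : ℝ) ≤ R := by
    have : 4 ≤ R := by omega
    exact_mod_cast this
  have hsep := D.sep j x hx x' hx' (by omega) (by omega)
  have h1 : ((R * bigSide ℓ Mh j : ℕ) : ℝ) = (R : ℝ) * bigSide ℓ Mh j := by push_cast; ring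
  rw [h1] at hsep
  have htri : supNorm (x - x') ≤ supNorm (x - t) + supNorm (t - x') := supNorm_sub_le_sub_add_sub x t x'
  have hsym : supNorm (t - x') = supNorm (x' - t) := by rw [← B4TorusKernel.supNorm_neg, neg_sub]
  rw [hsym] at htri
  have hbs : (0 : ℝ) ≤ (bigSide ℓ Mh j : ℝ) := by positivity
  nlinarith

end Domains

/-! ## §3 The `k`-level operator `Δ′_a` (2.13)–(2.14) on the fine box -/

/-- the coefficient of the level-`j` averaging term in lattice units: `a_j·(L^j)^{−2}·(L^{j(d+1)})^{−1}` — the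
`a_j(L^jη)^{d−2}|(Q′_jλ)(y)|²` of (2.14) with the normalised average `Q′_j` written as a sum over the `L^{j(d+1)}` sites of
the block and `η = 1`. [cite: Balaban1984PropagatorsII, (2.14) p.225] -/
def levC (d ℓ : ℕ) (a : ℕ → ℝ) (j : ℕ) : ℝ :=
  a j * (((((ℓ : ℝ) + 1)) ^ j) ^ 2)⁻¹ * (((((ℓ : ℝ) + 1)) ^ j) ^ (d + 1))⁻¹

/-- `levC` is positive for positive weights. [cite: Balaban1984PropagatorsII, (2.14) p.225] -/
theorem levC_pos (d ℓ : ℕ) {a : ℕ → ℝ} {j : ℕ} (ha : 0 < a j) : 0 < levC d ℓ a j := by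
  unfold levC; positivity

/-- the indicator of the territory `B^j(Λ_j)` on a presentation of the box. [cite: Balaban1984PropagatorsII, (2.3)–(2.4) p.224] -/
def indLev (N : Fin (d + 1) → ℕ) (lev : (Fin (d + 1) → ℤ) → ℕ) (j : ℕ) (x : ↥(boxDom N)) : ℝ :=
  if lev x.1 = j then 1 else 0

/-- **THE GENUINE `k`-LEVEL OPERATOR `Δ′_a = −Δ^{N}_X + Σ_{j=1}^{k} a_j(L^j)^{−2}Q′_j*1_{Λ_j}Q′_j` OF (2.13)–(2.14)** on the
fine box `Π_μ[0, N_μ)` (values form, lattice units, Neumann Laplacian), for a level function `lev` and weights `a`: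
the Laplacian `opBoxR 1 0 0 1 N` plus, for each level `j ≤ k`, `levC_j·1_{Λ_j}·[x ∼_j x′]·1_{Λ_j}`.
[cite: Balaban1984PropagatorsII, (2.13)–(2.14) p.225] -/
def mlOp (N : Fin (d + 1) → ℕ) (ℓ k : ℕ) (lev : (Fin (d + 1) → ℤ) → ℕ) (a : ℕ → ℝ) :
    Matrix ↥(boxDom N) ↥(boxDom N) ℝ :=
  opBoxR 1 0 0 1 N
    + ∑ j ∈ Finset.range (k + 1), levC d ℓ a j •
        (Matrix.diagonal (indLev N lev j) * opBoxR 0 0 1 ((ℓ + 1) ^ j) N * Matrix.diagonal (indLev N lev j))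

/-- entries of the pure Laplacian piece: `opBoxR 1 0 0 1 N = −Δ^N_X`. [folklore] -/
private theorem opBoxR_lap_apply (N : Fin (d + 1) → ℕ) (x y : ↥(boxDom N)) :
    opBoxR 1 0 0 1 N x y = neumannLapK N x.1 y.1 := by
  simp [opBoxR, B4BoxCov237.opBoxR, diagK, avgK]

/-- entries of the level-`j` averaging piece: `opBoxR 0 0 1 (L^j) N (x, y) = [y ∼_j x]`. [folklore] -/
private theorem opBoxR_avg_apply (N : Fin (d + 1) → ℕ) (b : ℕ) (x y : ↥(boxDom N)) :
    opBoxR 0 0 1 b N x y = if blk b y.1 = blk b x.1 then 1 else 0 := by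
  simp [opBoxR, B4BoxCov237.opBoxR, diagK, avgK, neumannLapK]

/-- entries of a sandwiched level piece. [folklore] -/
private theorem levPiece_apply (N : Fin (d + 1) → ℕ) (lev : (Fin (d + 1) → ℤ) → ℕ) (j b : ℕ) (x y : ↥(boxDom N)) :
    (Matrix.diagonal (indLev N lev j) * opBoxR 0 0 1 b N * Matrix.diagonal (indLev N lev j)) x y
      = if lev x.1 = j ∧ lev y.1 = j ∧ blk b y.1 = blk b x.1 then 1 else 0 := by
  rw [Matrix.mul_diagonal, Matrix.diagonal_mul, opBoxR_avg_apply]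
  unfold indLev
  by_cases h1 : lev x.1 = j <;> by_cases h2 : lev y.1 = j <;> by_cases h3 : blk b y.1 = blk b x.1 <;> simp [h1, h2, h3]

section Apply

variable {ℓ Mh k R : ℕ} {P : Fin (d + 1) → ℕ} (D : Domains d ℓ Mh k P R)

/-- **ENTRIES OF `Δ′_a`** on any presentation `N = N₀` of the box: `Δ′_a(x, x′) = (−Δ^N_X)(x, x′) +
levC_{lev x}·[x′ ∼_{lev x} x]` — the sum over levels collapses to the level of `x` because territories are unions of
blocks of their own level (`Domains.lev_eq_of_blk_eq`). [cite: Balaban1984PropagatorsII, (2.13)–(2.14) p.225] -/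
theorem mlOp_apply {N : Fin (d + 1) → ℕ} (hN : N = N0 ℓ Mh k P) (a : ℕ → ℝ) (x y : ↥(boxDom N)) :
    mlOp N ℓ k D.lev a x y
      = neumannLapK N x.1 y.1 + avgK (levC d ℓ a (D.lev x.1)) ((ℓ + 1) ^ D.lev x.1) x.1 y.1 := by
  have hx : x.1 ∈ boxDom (N0 ℓ Mh k P) := hN ▸ x.2
  have hy : y.1 ∈ boxDom (N0 ℓ Mh k P) := hN ▸ y.2
  unfold mlOp
  rw [Matrix.add_apply, opBoxR_lap_apply, Matrix.sum_apply]
  congr 1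
  have hterm : ∀ j, (levC d ℓ a j • (Matrix.diagonal (indLev N D.lev j) * opBoxR 0 0 1 ((ℓ + 1) ^ j) N
      * Matrix.diagonal (indLev N D.lev j))) x y
      = if D.lev x.1 = j ∧ D.lev y.1 = j ∧ blk ((ℓ + 1) ^ j) y.1 = blk ((ℓ + 1) ^ j) x.1 then levC d ℓ a j else 0 := by
    intro j
    rw [Matrix.smul_apply, smul_eq_mul, levPiece_apply]
    split_ifs <;> simp
  simp_rw [hterm]
  unfold avgK
  by_cases hb : blk ((ℓ + 1) ^ D.lev x.1) y.1 = blk ((ℓ + 1) ^ D.lev x.1) x.1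
  · rw [if_pos hb]
    have hly : D.lev y.1 = D.lev x.1 := D.lev_eq_of_blk_eq hx hy hb
    rw [Finset.sum_eq_single (D.lev x.1)]
    · rw [if_pos ⟨rfl, hly, hb⟩]
    · intro j _ hj
      rw [if_neg]
      rintro ⟨h1, -, -⟩
      exact hj h1.symm
    · intro h
      exact absurd (Finset.mem_range.2 (Nat.lt_succ_of_le (D.lev_le x.1))) h
  · rw [if_neg hb]
    refine Finset.sum_eq_zero fun j _ => ?_
    rw [if_neg]
    rintro ⟨h1, -, h3⟩
    rw [← h1] at h3
    exact hb h3

/-- the operator is transported by the cast between two presentations of the box (its entries only depend on the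
lattice points) — the rescaling bookkeeping «or of the size M if Λ_j is scaled to unit lattice» between the scales of
(2.40). [cite: Balaban1984PropagatorsII, p.229–230 («Rescaling all the expressions … to L^{−j}-scale»), dictionary] -/
theorem mlOp_boxCast {N N' : Fin (d + 1) → ℕ} (h : N = N') (lev : (Fin (d + 1) → ℤ) → ℕ) (a : ℕ → ℝ)
    (x y : ↥(boxDom N')) :
    mlOp N' ℓ k lev a x y = mlOp N ℓ k lev a ((boxCast h).symm x) ((boxCast h).symm y) := by
  subst h
  rfl

/-- as matrices: the operator on `N'` is the reindexing of the operator on `N` along the cast (same bookkeeping).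
[cite: Balaban1984PropagatorsII, p.229–230 («Rescaling all the expressions … to L^{−j}-scale»), dictionary] -/
theorem mlOp_eq_reindex {N N' : Fin (d + 1) → ℕ} (h : N = N') (lev : (Fin (d + 1) → ℤ) → ℕ) (a : ℕ → ℝ) :
    mlOp N' ℓ k lev a = Matrix.reindex (boxCast h) (boxCast h) (mlOp N ℓ k lev a) := by
  ext x y
  rw [Matrix.reindex_apply, Matrix.submatrix_apply, mlOp_boxCast h]

end Apply

/-! ## §4 Symmetry, the quadratic form, positivity and the inverse `G′ = Δ′_a⁻¹` -/

section Form

variable {N : Fin (d + 1) → ℕ} (ℓ k : ℕ) (lev : (Fin (d + 1) → ℤ) → ℕ) (a : ℕ → ℝ)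

/-- `Δ′_a` is a symmetric matrix. [cite: Balaban1984PropagatorsII, (2.13)–(2.14) p.225 (a quadratic form)] -/
theorem mlOp_isSymm : (mlOp N ℓ k lev a).IsSymm := by
  unfold mlOp
  refine (opBoxR_isSymm _ _ _ _ _).add ?_
  unfold Matrix.IsSymm
  rw [Matrix.transpose_sum]
  refine Finset.sum_congr rfl fun j _ => ?_
  rw [Matrix.transpose_smul, Matrix.transpose_mul, Matrix.transpose_mul, Matrix.diagonal_transpose,
    (opBoxR_isSymm _ _ _ _ _).eq, ← Matrix.mul_assoc]

/-- the sandwiched piece acts as `1_{Λ_j}·A·1_{Λ_j}`. [folklore] -/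
private theorem levPiece_mulVec (j b : ℕ) (v : ↥(boxDom N) → ℝ) :
    (Matrix.diagonal (indLev N lev j) * opBoxR 0 0 1 b N * Matrix.diagonal (indLev N lev j)) *ᵥ v
      = Matrix.diagonal (indLev N lev j) *ᵥ (opBoxR 0 0 1 b N *ᵥ fun x => indLev N lev j x * v x) := by
  rw [← Matrix.mulVec_mulVec, ← Matrix.mulVec_mulVec]
  congr 2
  funext x
  exact Matrix.mulVec_diagonal _ _ x

/-- `⟨v, D w⟩ = ⟨Dv, w⟩` for a real diagonal `D`. [folklore] -/
private theorem dotProduct_diagonal_mulVec (f v w : ↥(boxDom N) → ℝ) :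
    v ⬝ᵥ (Matrix.diagonal f *ᵥ w) = (fun x => f x * v x) ⬝ᵥ w := by
  unfold dotProduct
  refine Finset.sum_congr rfl fun x _ => ?_
  rw [Matrix.mulVec_diagonal]
  ring

/-- **THE QUADRATIC FORM OF `Δ′_a`** (2.14) in lattice units:
`⟨v, Δ′_av⟩ = ½Σ_xΣ_{x′∼x}(v_x − v_{x′})² + Σ_{j≤k} levC_j·Σ_{j-blocks β}(Σ_{x∈β, lev x = j} v_x)²`.
[cite: Balaban1984PropagatorsII, (2.13)–(2.14) p.225] -/
theorem mlOp_form (v : ↥(boxDom N) → ℝ) :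
    v ⬝ᵥ mlOp N ℓ k lev a *ᵥ v
      = 1 / 2 * (∑ x, ∑ y ∈ boxNbrs N x, (v x - v y) ^ 2)
        + ∑ j ∈ Finset.range (k + 1), levC d ℓ a j *
            ∑ β ∈ Finset.univ.image (fun x : ↥(boxDom N) => blk ((ℓ + 1) ^ j) x.1),
              (∑ y ∈ Finset.univ.filter (fun y : ↥(boxDom N) => blk ((ℓ + 1) ^ j) y.1 = β),
                indLev N lev j y * v y) ^ 2 := by
  unfold mlOp
  rw [Matrix.add_mulVec, dotProduct_add, quadFormR_eq]
  simp only [zero_mul, add_zero]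
  congr 1
  rw [Matrix.sum_mulVec, dotProduct_sum]
  refine Finset.sum_congr rfl fun j _ => ?_
  rw [Matrix.smul_mulVec, dotProduct_smul, smul_eq_mul, levPiece_mulVec, dotProduct_diagonal_mulVec,
    quadFormR_eq]
  simp only [zero_div, zero_mul, zero_add, add_zero, one_mul]

variable {ℓ k lev a}

/-- the form is the sum of two nonnegative parts; both vanish on a null vector. [folklore] -/
private theorem form_parts_eq_zero_of_mulVec_eq_zero (ha : ∀ j, 0 < a j) {v : ↥(boxDom N) → ℝ}
    (hv : mlOp N ℓ k lev a *ᵥ v = 0) :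
    (∑ x, ∑ y ∈ boxNbrs N x, (v x - v y) ^ 2) = 0 ∧
      ∀ j ∈ Finset.range (k + 1),
        ∑ β ∈ Finset.univ.image (fun x : ↥(boxDom N) => blk ((ℓ + 1) ^ j) x.1),
          (∑ y ∈ Finset.univ.filter (fun y : ↥(boxDom N) => blk ((ℓ + 1) ^ j) y.1 = β),
            indLev N lev j y * v y) ^ 2 = 0 := by
  have hform := mlOp_form (N := N) ℓ k lev a v
  rw [hv, dotProduct_zero] at hform
  have hB : 0 ≤ ∑ x, ∑ y ∈ boxNbrs N x, (v x - v y) ^ 2 :=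
    Finset.sum_nonneg fun x _ => Finset.sum_nonneg fun y _ => sq_nonneg _
  have hSj : ∀ j ∈ Finset.range (k + 1), 0 ≤ levC d ℓ a j *
      ∑ β ∈ Finset.univ.image (fun x : ↥(boxDom N) => blk ((ℓ + 1) ^ j) x.1),
        (∑ y ∈ Finset.univ.filter (fun y : ↥(boxDom N) => blk ((ℓ + 1) ^ j) y.1 = β),
          indLev N lev j y * v y) ^ 2 :=
    fun j _ => mul_nonneg (levC_pos d ℓ (ha j)).le (Finset.sum_nonneg fun β _ => sq_nonneg _)
  have hS : 0 ≤ ∑ j ∈ Finset.range (k + 1), levC d ℓ a j *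
      ∑ β ∈ Finset.univ.image (fun x : ↥(boxDom N) => blk ((ℓ + 1) ^ j) x.1),
        (∑ y ∈ Finset.univ.filter (fun y : ↥(boxDom N) => blk ((ℓ + 1) ^ j) y.1 = β),
          indLev N lev j y * v y) ^ 2 := Finset.sum_nonneg hSj
  have hB0 : (∑ x, ∑ y ∈ boxNbrs N x, (v x - v y) ^ 2) = 0 := by linarith
  have hS0 : ∑ j ∈ Finset.range (k + 1), levC d ℓ a j *
      ∑ β ∈ Finset.univ.image (fun x : ↥(boxDom N) => blk ((ℓ + 1) ^ j) x.1),
        (∑ y ∈ Finset.univ.filter (fun y : ↥(boxDom N) => blk ((ℓ + 1) ^ j) y.1 = β),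
          indLev N lev j y * v y) ^ 2 = 0 := by linarith
  refine ⟨hB0, fun j hj => ?_⟩
  have h := (Finset.sum_eq_zero_iff_of_nonneg hSj).1 hS0 j hj
  rcases mul_eq_zero.1 h with h | h
  · exact absurd h (levC_pos d ℓ (ha j)).ne'
  · exact h

/-- **`Δ′_a` IS INJECTIVE** («G′ = Δ′_a^{−1} is a well defined, positive operator»): a null vector has zero bond form,
hence is constant on the (connected) box, and the block form of the territory block of the corner kills the constant —
for every level function with `lev ≤ k` and all positive weights. [cite: Balaban1984PropagatorsII, p.225 («The operator G′ = Δ′_a^{−1} is a well defined, positive operator»)] -/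
theorem mlOp_mulVec_injective (hN : ∀ i, 1 ≤ N i) (hlev : ∀ x, lev x ≤ k) (ha : ∀ j, 0 < a j) :
    Function.Injective (mlOp N ℓ k lev a).mulVec := by
  classical
  intro v w hvw
  rw [← sub_eq_zero]
  set u := v - w with hu
  have h0 : mlOp N ℓ k lev a *ᵥ u = 0 := by rw [hu, Matrix.mulVec_sub, hvw, sub_self]
  obtain ⟨hB, hS⟩ := form_parts_eq_zero_of_mulVec_eq_zero ha h0
  -- zero bond form: `u` is constant along box bonds, hence constant
  have hbond : ∀ x : ↥(boxDom N), ∀ y ∈ boxNbrs N x, u x = u y := by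
    intro x y hy
    have hx := (Finset.sum_eq_zero_iff_of_nonneg fun x _ =>
      Finset.sum_nonneg fun y _ => sq_nonneg (u x - u y)).1 hB x (Finset.mem_univ x)
    have hxy := (Finset.sum_eq_zero_iff_of_nonneg fun y _ => sq_nonneg (u x - u y)).1 hx y hy
    exact sub_eq_zero.1 (pow_eq_zero_iff (two_ne_zero) |>.1 hxy)
  set x₀ : ↥(boxDom N) := ⟨0, zero_mem_boxDom hN⟩ with hx₀
  have hconst : ∀ x : ↥(boxDom N), u x = u x₀ := by
    intro x
    have hc := box_const_of_bonds hN (u := fun x => (u x : ℂ))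
      (fun x y hy => by exact_mod_cast hbond x y hy) x
    exact_mod_cast hc
  -- zero block form at the level of the corner: the territory block of `x₀` carries `card • u x₀ = 0`
  set j := lev x₀.1 with hj
  have hjk : j ∈ Finset.range (k + 1) := Finset.mem_range.2 (Nat.lt_succ_of_le (hlev _))
  have hSj := hS j hjk
  have hβ := (Finset.sum_eq_zero_iff_of_nonneg fun β _ => sq_nonneg _).1 hSj (blk ((ℓ + 1) ^ j) x₀.1)
    (Finset.mem_image_of_mem _ (Finset.mem_univ x₀))
  have hsum0 : ∑ y ∈ Finset.univ.filter (fun y : ↥(boxDom N) => blk ((ℓ + 1) ^ j) y.1 = blk ((ℓ + 1) ^ j) x₀.1),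
      indLev N lev j y * u y = 0 := pow_eq_zero_iff two_ne_zero |>.1 hβ
  -- rewrite the inner sum as `(number of sites of level j in the block) • u x₀`
  have hterm : ∀ y ∈ Finset.univ.filter (fun y : ↥(boxDom N) => blk ((ℓ + 1) ^ j) y.1 = blk ((ℓ + 1) ^ j) x₀.1),
      indLev N lev j y * u y = (if lev y.1 = j then 1 else 0) * u x₀ := by
    intro y _
    rw [hconst y]; rfl
  rw [Finset.sum_congr rfl hterm, ← Finset.sum_mul, Finset.sum_boole] at hsum0
  have hmem : x₀ ∈ (Finset.univ.filter (fun y : ↥(boxDom N) => blk ((ℓ + 1) ^ j) y.1 = blk ((ℓ + 1) ^ j) x₀.1)).filter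
      (fun y => lev y.1 = j) := by
    simp [hj]
  have hcard : (((Finset.univ.filter (fun y : ↥(boxDom N) => blk ((ℓ + 1) ^ j) y.1 = blk ((ℓ + 1) ^ j) x₀.1)).filter
      (fun y => lev y.1 = j)).card : ℝ) ≠ 0 := by
    exact_mod_cast Finset.card_ne_zero.2 ⟨x₀, hmem⟩
  have hc : u x₀ = 0 := by
    rcases mul_eq_zero.1 hsum0 with hz | hz
    · exact absurd hz hcard
    · exact hz
  funext x
  rw [hconst x, hc]
  rfl

/-- `Δ′_a` is a unit of the matrix ring. [cite: Balaban1984PropagatorsII, p.225 («G′ = Δ′_a^{−1} is … well defined»)] -/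
theorem mlOp_isUnit (hN : ∀ i, 1 ≤ N i) (hlev : ∀ x, lev x ≤ k) (ha : ∀ j, 0 < a j) :
    IsUnit (mlOp N ℓ k lev a) :=
  Matrix.mulVec_injective_iff_isUnit.1 (mlOp_mulVec_injective hN hlev ha)

variable (N ℓ k lev a)

/-- **`G′ = Δ′_a^{−1}`**, the inverse of the `k`-level operator (the object of Proposition 2.2).
[cite: Balaban1984PropagatorsII, p.225 («The operator G′ = Δ′_a^{−1}»), Prop. 2.2 p.234] -/
def gml : Matrix ↥(boxDom N) ↥(boxDom N) ℝ := (mlOp N ℓ k lev a)⁻¹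

variable {N ℓ k lev a}

/-- `Δ′_a·G′ = 1`. [cite: Balaban1984PropagatorsII, p.225 («G′ = Δ′_a^{−1} is a well defined … operator»)] -/
theorem mlOp_mul_gml (hN : ∀ i, 1 ≤ N i) (hlev : ∀ x, lev x ≤ k) (ha : ∀ j, 0 < a j) :
    mlOp N ℓ k lev a * gml N ℓ k lev a = 1 :=
  Matrix.mul_nonsing_inv _ ((Matrix.isUnit_iff_isUnit_det _).1 (mlOp_isUnit hN hlev ha))

/-- `G′·Δ′_a = 1`. [cite: Balaban1984PropagatorsII, p.225 («G′ = Δ′_a^{−1} is a well defined … operator»)] -/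
theorem gml_mul_mlOp (hN : ∀ i, 1 ≤ N i) (hlev : ∀ x, lev x ≤ k) (ha : ∀ j, 0 < a j) :
    gml N ℓ k lev a * mlOp N ℓ k lev a = 1 :=
  Matrix.nonsing_inv_mul _ ((Matrix.isUnit_iff_isUnit_det _).1 (mlOp_isUnit hN hlev ha))

/-- `G′` is symmetric. [cite: Balaban1984PropagatorsII, p.225 («a well defined, positive operator»)] -/
theorem gml_isSymm : (gml N ℓ k lev a).IsSymm := by
  unfold gml Matrix.IsSymm
  rw [Matrix.transpose_nonsing_inv, (mlOp_isSymm ℓ k lev a).eq]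

/-- the quadratic form of `Δ′_a` is nonnegative. [cite: Balaban1984PropagatorsII, (2.13)–(2.14) p.225] -/
theorem mlOp_form_nonneg (ha : ∀ j, 0 < a j) (v : ↥(boxDom N) → ℝ) : 0 ≤ v ⬝ᵥ mlOp N ℓ k lev a *ᵥ v := by
  rw [mlOp_form]
  refine add_nonneg (mul_nonneg (by norm_num) (Finset.sum_nonneg fun x _ =>
    Finset.sum_nonneg fun y _ => sq_nonneg _)) (Finset.sum_nonneg fun j _ => ?_)
  exact mul_nonneg (levC_pos d ℓ (ha j)).le (Finset.sum_nonneg fun β _ => sq_nonneg _)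

/-- **`G′` IS POSITIVE**: `⟨f, G′f⟩ = ⟨G′f, Δ′_aG′f⟩ ≥ 0` («a well defined, positive operator»).
[cite: Balaban1984PropagatorsII, p.225 («The operator G′ = Δ′_a^{−1} is a well defined, positive operator»)] -/
theorem gml_form_nonneg (hN : ∀ i, 1 ≤ N i) (hlev : ∀ x, lev x ≤ k) (ha : ∀ j, 0 < a j)
    (f : ↥(boxDom N) → ℝ) : 0 ≤ f ⬝ᵥ gml N ℓ k lev a *ᵥ f := by
  set g := gml N ℓ k lev a *ᵥ f with hg
  have hf : mlOp N ℓ k lev a *ᵥ g = f := by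
    rw [hg, Matrix.mulVec_mulVec, mlOp_mul_gml hN hlev ha, Matrix.one_mulVec]
  calc (0 : ℝ) ≤ g ⬝ᵥ mlOp N ℓ k lev a *ᵥ g := mlOp_form_nonneg ha g
    _ = (mlOp N ℓ k lev a *ᵥ g) ⬝ᵥ g := dotProduct_comm _ _
    _ = f ⬝ᵥ g := by rw [hf]

end Form

/-! ## §5 The printed weights `a_j = B1.aSeq a L j` -/

/-- print's running constants `a_j`, `j ≥ 1` («a_{j+1} = aa_j/(aL^{−2} + a_j), a₁ = a», = [B1] (2.15) `B1.aSeq`).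
[cite: Balaban1984PropagatorsII, (2.14) p.225; Balaban1982Higgs1, (2.15) p.609] -/
def aPrinted (ℓ : ℕ) (a : ℝ) (j : ℕ) : ℝ := B1.aSeq a ((ℓ : ℝ) + 1) j

/-- `a₁ = a`. [cite: Balaban1984PropagatorsII, (2.14) p.225 («a₁ = a»)] -/
theorem aPrinted_one {ℓ : ℕ} (hℓ : 1 ≤ ℓ) (a : ℝ) : aPrinted ℓ a 1 = a :=
  B1.aSeq_one (one_lt_L_real hℓ)

/-- the recursion «a_{j+1} = aa_j/(aL^{−2} + a_j)»: `a_{j+1} = aNext ℓ a_j a` (`j ≥ 1`). [cite: Balaban1984PropagatorsII, (2.14) p.225] -/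
theorem aPrinted_succ {ℓ : ℕ} (hℓ : 1 ≤ ℓ) {a : ℝ} (ha : 0 < a) {j : ℕ} (hj : 1 ≤ j) :
    aPrinted ℓ a (j + 1) = aNext ℓ (aPrinted ℓ a j) a :=
  (aNext_aSeq hℓ ha hj).symm

/-- the window `a(1 − L^{−2}) ≤ a_j ≤ a`, `0 < a_j` (`j ≥ 1`) — uniformity of the weights along the printed sequence.
[cite: Balaban1982Higgs1, (2.15) p.609] -/
theorem aPrinted_window {ℓ : ℕ} (hℓ : 1 ≤ ℓ) {a : ℝ} (ha : 0 < a) {j : ℕ} (hj : 1 ≤ j) :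
    a * (1 - ((((ℓ : ℝ) + 1)) ^ 2)⁻¹) ≤ aPrinted ℓ a j ∧ aPrinted ℓ a j ≤ a ∧ 0 < aPrinted ℓ a j :=
  aSeq_window hℓ ha le_rfl le_rfl hj

end

end Literature.MathematicalPhysics.QuantumFieldTheory.Balaban1983to89.B6MultiLevelBoxOperator
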